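import Mathlib
import Literature.NumberTheory.DiophantineGeometry.SchurWeylPlethysm
import Literature.Computability.AlgebraicComplexity.ApolarityAction
import Literature.Computability.AlgebraicComplexity.OrbitClosureProofs

/-!
# Four-row tangent rank: transfer between `m` and `m + 1` (crux `ValuativeGCT.ValuativeFlip`)

Helper file (`--supports stmt-ValiantsHypothesis-12624`) for line `four-row-count`
(`Cruxes/ValuativeFlip/Lines/four_row_count.lean`), per-side stub `stub_fourRowPencilRank`:
for `n ≤ m ≤ (6/5)·n` some `g ∈ GL_{m²}` makes the four-row tangent span
`span{X_a · (∂_b (g · X₀₀^{m-n} per_n))|_{four kept variables} : a kept, b}` at least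
`2m² + m + 2`-dimensional.

**The transfer.**  For a `g` realising a four-variable pencil — `(g · X_c)|₄ = M_c(y)` on the block
cells `c`, `(g · X₀₀)|₄ = ℓ(y)` — the chain rule and `GL`-invariance of spans give
`span_b {(∂_b (g·pp))|₄} = span_c {ℓ^{m-n} (∂_c per_n)(M(y))} + ⟨(m-n) ℓ^{m-n-1} per_n(M(y))⟩`, so the
four-row span contains `ℓ^{m-n} · span{y_t (∂_c per_n)(M(y))}`, an injective image of a space that
does not depend on `m`: the per-side four-row rank attainable at level `m` transfers verbatim to
level `m + 1` (and to every level), which is the representation-stability of this quantity in `m`.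

* `frt_exists_gl_of_rows` — completion of prescribed rows (with an invertible minor) to `g ∈ GL`;
* `frt_span_range_sum_smul_eq` — `span {Σ_c g_{bc} v_c : b} = span {v_c}` for invertible `g`;
* `frt_paddedPerFormLex_eq` — `X₀₀^{m-n} per_n` along an enumeration of the block;
* `frt_finrank_fourRowSpan_ge` — realisation + transfer: at every `m ≥ n`, `m ≥ 2`, the four-row
  span of some `g · pp` has dimension `≥ dim span{y_t (∂_{ij} per_n)(M(y))}` for any pencil `M`
  with four cells carrying independent forms;
* `fourRowPencilRank_of_pencilCertificate` — hence the registered stub (verbatim) follows from an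
  `m`-FREE certificate: for all large `n`, a pencil `M` with
  `dim span{y_t (∂_{ij} per_n)(M(y))} ≥ 2⌊6n/5⌋² + ⌊6n/5⌋ + 2`.

What remains of the stub after this file: the `m`-free four-variable rank certificate for `per_n`
(line card: cyclic 4-band with small integer weights; generic value `min(C(n+3,3), 4n²-2n+2)`).
-/

set_option linter.dupNamespace false

namespace Summit.ValiantsHypothesis.ValiantsHypothesis.Theorems.ValuativeFlip

open MvPolynomial Literature.NumberTheory.DiophantineGeometry
open Literature.Computability.AlgebraicComplexity

noncomputable section

/-- **Completion to an invertible matrix with prescribed rows.** If the prescribed row vectors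
`i ↦ w i t` (`t : α`, to sit in the rows `κ t`) have an invertible `α × α` minor (columns `c t'`),
then some `g ∈ GL` has exactly these rows at the positions `κ t`: permute the columns `c t'` under
the positions `κ t'` and complete by identity rows (block triangular). [folklore] -/
theorem frt_exists_gl_of_rows {ι α K : Type*} [Fintype ι] [DecidableEq ι] [Fintype α]
    [DecidableEq α] [Field K] (κ : α → ι) (hκ : Function.Injective κ) (w : ι → α → K) (c : α → ι)
    (hc : IsUnit (Matrix.of fun t t' : α => w (c t') t)) :
    ∃ g : GL ι K, ∀ t i, (g : Matrix ι ι K) (κ t) i = w i t := by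
  classical
  have hcdet : (Matrix.of fun t t' : α => w (c t') t).det ≠ 0 :=
    ((Matrix.isUnit_iff_isUnit_det _).mp hc).ne_zero
  have hcinj : Function.Injective c := by
    intro t₁ t₂ h
    by_contra hne
    exact hcdet (Matrix.det_zero_of_column_eq hne fun t => by simp [h])
  -- the permutation `π` with `π (κ t) = c t`
  set p : ι → Prop := fun x => x ∈ Set.range κ with hp
  set q : ι → Prop := fun x => x ∈ Set.range c with hq
  let e : {x // p x} ≃ {x // q x} :=
    (Equiv.ofInjective κ hκ).symm.trans (Equiv.ofInjective c hcinj)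
  let π : Equiv.Perm ι := e.extendSubtype
  have hπ : ∀ t, π (κ t) = c t := by
    intro t
    have h1 : p (κ t) := ⟨t, rfl⟩
    have h2 : π (κ t) = (e ⟨κ t, h1⟩ : ι) := Equiv.extendSubtype_apply_of_mem e _ h1
    rw [h2]
    simp only [e, Equiv.trans_apply]
    have h3 : (Equiv.ofInjective κ hκ).symm ⟨κ t, h1⟩ = t := by
      have : (⟨κ t, h1⟩ : {x // p x}) = Equiv.ofInjective κ hκ t := rfl
      rw [this, Equiv.symm_apply_apply]
    rw [h3]
    rfl
  -- the block-triangular matrix with rows `u t = (w (π j) t)_j` at `κ t` and identity rows elsewhere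
  let tOf : {x // p x} → α := fun a => (Equiv.ofInjective κ hκ).symm a
  have htOf : ∀ t (h : p (κ t)), tOf ⟨κ t, h⟩ = t := by
    intro t h
    have : (⟨κ t, h⟩ : {x // p x}) = Equiv.ofInjective κ hκ t := rfl
    simp only [tOf]
    rw [this, Equiv.symm_apply_apply]
  let A : Matrix {x // p x} {x // p x} K := fun a a' => w (π a'.1) (tOf a)
  let B : Matrix {x // p x} {x // ¬p x} K := fun a j => w (π j.1) (tOf a)
  let g₁ : Matrix ι ι K :=
    Matrix.reindex (Equiv.sumCompl p) (Equiv.sumCompl p) (Matrix.fromBlocks A B 0 1)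
  have hA : A = Matrix.reindex (Equiv.ofInjective κ hκ) (Equiv.ofInjective κ hκ)
      (Matrix.of fun t t' : α => w (c t') t) := by
    ext a a'
    obtain ⟨t, rfl⟩ := (Equiv.ofInjective κ hκ).surjective a
    obtain ⟨t', rfl⟩ := (Equiv.ofInjective κ hκ).surjective a'
    simp only [A, tOf, Matrix.reindex_apply, Matrix.submatrix_apply, Equiv.symm_apply_apply,
      Matrix.of_apply]
    have : ((Equiv.ofInjective κ hκ t' : {x // p x}) : ι) = κ t' := rfl
    rw [this, hπ]
  have hA' : A.det ≠ 0 := by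
    rw [hA, Matrix.det_reindex_self]
    exact hcdet
  have hg₁ : g₁.det ≠ 0 := by
    simp only [g₁, Matrix.det_reindex_self, Matrix.det_fromBlocks_zero₂₁, Matrix.det_one, mul_one]
    exact hA'
  have hP : (π.permMatrix K).det ≠ 0 := by
    rw [Matrix.det_permutation]
    rcases Int.units_eq_one_or (Equiv.Perm.sign π) with h | h <;> simp [h]
  have hg : (g₁ * π.permMatrix K).det ≠ 0 := by
    rw [Matrix.det_mul]
    exact mul_ne_zero hg₁ hP
  refine ⟨Matrix.GeneralLinearGroup.mkOfDetNeZero _ hg, fun t i => ?_⟩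
  have h1 : p (κ t) := ⟨t, rfl⟩
  have hrow : ∀ j, g₁ (κ t) j = w (π j) t := by
    intro j
    simp only [g₁, Matrix.reindex_apply, Matrix.submatrix_apply]
    rw [Equiv.sumCompl_symm_apply_of_pos (p := p) h1]
    by_cases hj : p j
    · rw [Equiv.sumCompl_symm_apply_of_pos (p := p) hj, Matrix.fromBlocks_apply₁₁]
      simp only [A]
      rw [htOf t h1]
    · rw [Equiv.sumCompl_symm_apply_of_neg (p := p) hj, Matrix.fromBlocks_apply₁₂]
      simp only [B]
      rw [htOf t h1]
  show (g₁ * π.permMatrix K) (κ t) i = w i t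
  rw [PEquiv.mul_toMatrix_toPEquiv, Matrix.submatrix_apply, id, hrow,
    Equiv.apply_symm_apply]

/-- **`GL`-invariance of a span.** Re-mixing a finite family by an invertible matrix does not
change its span: `span {∑ c, g b c • v c : b} = span {v c : c}`. [folklore] -/
theorem frt_span_range_sum_smul_eq {ι K V : Type*} [Fintype ι] [DecidableEq ι] [Field K]
    [AddCommGroup V] [Module K V] (g : GL ι K) (v : ι → V) :
    Submodule.span K (Set.range fun b => ∑ c, (g : Matrix ι ι K) b c • v c) =
      Submodule.span K (Set.range v) := by
  apply le_antisymm
  · rw [Submodule.span_le]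
    rintro _ ⟨b, rfl⟩
    exact Submodule.sum_mem _ fun c _ => Submodule.smul_mem _ _ (Submodule.subset_span ⟨c, rfl⟩)
  · rw [Submodule.span_le]
    rintro _ ⟨c, rfl⟩
    have h : v c = ∑ b, ((g⁻¹ : GL ι K) : Matrix ι ι K) c b • ∑ c', (g : Matrix ι ι K) b c' • v c' := by
      simp_rw [Finset.smul_sum, smul_smul]
      rw [Finset.sum_comm]
      simp_rw [← Finset.sum_smul, ← Matrix.mul_apply]
      rw [show ((g⁻¹ : GL ι K) : Matrix ι ι K) * (g : Matrix ι ι K) = 1 from by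
        rw [← Units.val_mul, inv_mul_cancel, Units.val_one]]
      simp [Matrix.one_apply, ite_smul, Finset.sum_ite_eq]
    rw [h]
    exact Submodule.sum_mem _ fun b _ => Submodule.smul_mem _ _ (Submodule.subset_span ⟨b, rfl⟩)

/-- The padded permanent in the lexicographic matrix variables, unfolded along an enumeration
`σ' : Fin n ≃ BlockIdx n m` of the block: `X₀₀ ^ (m - n) · per_n (X_E)` with
`E ij = toLex (σ' i, σ' j)`. [folklore] -/
theorem frt_paddedPerFormLex_eq (n m : ℕ) [NeZero m] (σ' : Fin n ≃ BlockIdx n m) :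
    paddedPerFormLex ℂ n m = (X (toLex ((0 : Fin m), (0 : Fin m))) : MvPolynomial (MatIdx m) ℂ) ^ (m - n) *
      rename (fun ij : Fin n × Fin n => (toLex (((σ' ij.1 : BlockIdx n m) : Fin m), ((σ' ij.2 : BlockIdx n m) : Fin m)) : MatIdx m))
        (perPoly (Fin n) ℂ) := by
  simp only [paddedPerFormLex, paddedPerPoly]
  rw [← rename_perPoly_equiv (k := ℂ) σ']
  simp only [map_mul, map_pow, rename_X, rename_rename]
  rfl

/-- **Realisation and transfer of a four-variable pencil certificate to every level `m ≥ n`.**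
Let `M` assign to each cell of an `n × n` matrix a linear form in four variables `y₀..y₃`, with
four cells `c t'` carrying linearly independent forms.  Then for every `m ≥ n`, `m ≥ 2`, some
`g ∈ GL_{m²}` makes the four-row tangent span of `g · X₀₀^{m-n} per_n` (restriction to the four
kept variables of `X_a ∂_b (g · pp)`, `a` kept) contain an injective image
(`q ↦ ℓ^{m-n} · q(y ↦ kept variables)`, `ℓ` a kept variable) of the `m`-free span
`span{y_t · (∂_{ij} per_n)(M(y))}`; in particular its dimension is at least the `m`-free one.
Ingredients: completion of the prescribed rows to `g ∈ GL` (`frt_exists_gl_of_rows`), the chain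
rule `∂_b (g·f) = Σ_j g_{bj} g·(∂_j f)` (`pderiv_linSubst_eq_sum`) and `GL`-invariance of the span
(`frt_span_range_sum_smul_eq`), and `∂_{E ij}(X₀₀^{m-n} per_n(X_E)) = X₀₀^{m-n} (∂_{ij} per_n)(X_E)`.
This is the `m ↔ m+1` transfer of the per-side four-row rank: the attainable ranks at level `m`
dominate an `m`-independent quantity. [folklore; this crux's line four-row-count] -/
theorem frt_finrank_fourRowSpan_ge (n m : ℕ) [NeZero m] (hnm : n ≤ m) (hm : 2 ≤ m)
    (M : Fin n × Fin n → Fin 4 → ℂ) (c : Fin 4 → Fin n × Fin n)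
    (hc : IsUnit (Matrix.of fun t t' : Fin 4 => M (c t') t)) :
    ∃ g : GL (MatIdx m) ℂ,
      Module.finrank ℂ ↥(Submodule.span ℂ (Set.range fun tc : Fin 4 × (Fin n × Fin n) =>
        (X tc.1 : MvPolynomial (Fin 4) ℂ) *
          aeval (fun ij : Fin n × Fin n => ∑ t : Fin 4, M ij t • (X t : MvPolynomial (Fin 4) ℂ))
            (pderiv tc.2 (perPoly (Fin n) ℂ)))) ≤
      Module.finrank ℂ ↥(Submodule.span ℂ (Set.range fun ab : {a : MatIdx m // m * m ≤ (((matIdxEquiv m).symm a : Fin (m * m)) : ℕ) + 4} × MatIdx m => (MvPolynomial.X ab.1.1 : MvPolynomial (MatIdx m) ℂ) * MvPolynomial.aeval (fun i : MatIdx m => if m * m ≤ (((matIdxEquiv m).symm i : Fin (m * m)) : ℕ) + 4 then (MvPolynomial.X i : MvPolynomial (MatIdx m) ℂ) else 0) (MvPolynomial.pderiv ab.2 (linSubst (MatIdx m) ℂ ((g : GL (MatIdx m) ℂ) : Matrix (MatIdx m) (MatIdx m) ℂ) (paddedPerFormLex ℂ n m))))) := by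
  classical
  -- the four kept variables `κ t`, `t : Fin 4`
  have h4 : 4 ≤ m * m := Nat.mul_le_mul hm hm
  let κ : Fin 4 → MatIdx m := fun t => matIdxEquiv m ⟨m * m - 4 + (t : ℕ), by have := t.2; omega⟩
  have hκ : Function.Injective κ := by
    intro t₁ t₂ h
    have h' := congr_arg (fun i => (((matIdxEquiv m).symm i : Fin (m * m)) : ℕ)) h
    simp only [κ, OrderIso.symm_apply_apply] at h'
    exact Fin.ext (by omega)
  have hkept : ∀ i : MatIdx m,
      m * m ≤ (((matIdxEquiv m).symm i : Fin (m * m)) : ℕ) + 4 ↔ i ∈ Set.range κ := by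
    intro i
    constructor
    · intro hi
      have hlt := ((matIdxEquiv m).symm i).2
      refine ⟨⟨(((matIdxEquiv m).symm i : Fin (m * m)) : ℕ) + 4 - m * m, by omega⟩, ?_⟩
      simp only [κ]
      conv_rhs => rw [← (matIdxEquiv m).apply_symm_apply i]
      congr 1
      exact Fin.ext (by simp only; omega)
    · rintro ⟨t, rfl⟩
      simp only [κ, OrderIso.symm_apply_apply]
      omega
  -- the block embedding `E` and the padding variable `o`
  let σ' : Fin n ≃ BlockIdx n m := (Fintype.equivFinOfCardEq (card_blockIdx hnm)).symm
  let E : Fin n × Fin n → MatIdx m := fun ij =>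
    toLex (((σ' ij.1 : BlockIdx n m) : Fin m), ((σ' ij.2 : BlockIdx n m) : Fin m))
  have hE : Function.Injective E := by
    intro x y h
    have h1 := congr_arg (fun z : MatIdx m => (ofLex z).1) h
    have h2 := congr_arg (fun z : MatIdx m => (ofLex z).2) h
    simp only [E, ofLex_toLex] at h1 h2
    exact Prod.ext (σ'.injective (Subtype.ext h1)) (σ'.injective (Subtype.ext h2))
  let o : MatIdx m := toLex ((0 : Fin m), (0 : Fin m))
  have hEo : n < m → ∀ ij, E ij ≠ o := by
    intro hlt ij h
    have h1 := congr_arg (fun z : MatIdx m => ((ofLex z).1 : ℕ)) h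
    simp only [E, o, ofLex_toLex, Fin.val_zero] at h1
    have h2 := (σ' ij.1).2
    omega
  set per : MvPolynomial (Fin n × Fin n) ℂ := perPoly (Fin n) ℂ with hper
  set f : MvPolynomial (MatIdx m) ℂ := paddedPerFormLex ℂ n m with hfdef
  have hf : f = X o ^ (m - n) * rename E per := frt_paddedPerFormLex_eq n m σ'
  -- the prescribed rows and the realising `g`
  let w : MatIdx m → Fin 4 → ℂ := fun i =>
    if h : ∃ ij, E ij = i then M h.choose else if i = o then Pi.single 0 1 else 0
  have hwE : ∀ ij, w (E ij) = M ij := by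
    intro ij
    have h : ∃ ij', E ij' = E ij := ⟨ij, rfl⟩
    simp only [w, dif_pos h]
    rw [hE h.choose_spec]
  have hwo : n < m → w o = Pi.single 0 1 := by
    intro hlt
    have h : ¬∃ ij, E ij = o := fun ⟨ij, hij⟩ => hEo hlt ij hij
    simp only [w, dif_neg h, if_true]
  have hc' : IsUnit (Matrix.of fun t t' : Fin 4 => w (E (c t')) t) := by
    simp_rw [hwE]
    exact hc
  obtain ⟨g, hg⟩ := frt_exists_gl_of_rows κ hκ w (fun t => E (c t)) hc'
  refine ⟨g, ?_⟩
  -- the restriction `R₄` to the kept variables and `ψ = R₄ ∘ (g · )`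
  set R4 : MatIdx m → MvPolynomial (MatIdx m) ℂ := fun i : MatIdx m =>
    if m * m ≤ (((matIdxEquiv m).symm i : Fin (m * m)) : ℕ) + 4 then
      (MvPolynomial.X i : MvPolynomial (MatIdx m) ℂ) else 0 with hR4
  let ψ : MvPolynomial (MatIdx m) ℂ →ₐ[ℂ] MvPolynomial (MatIdx m) ℂ :=
    (aeval R4).comp (linSubst (MatIdx m) ℂ (g : Matrix (MatIdx m) (MatIdx m) ℂ))
  have hfilter : (Finset.univ.filter fun j : MatIdx m =>
      m * m ≤ (((matIdxEquiv m).symm j : Fin (m * m)) : ℕ) + 4) = Finset.univ.map ⟨κ, hκ⟩ := by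
    ext j
    simp only [Finset.mem_filter, Finset.mem_univ, true_and, Finset.mem_map,
      Function.Embedding.coeFn_mk, hkept, Set.mem_range]
  have hψX : ∀ i, ψ (X i) = rename κ (∑ t, w i t • X t) := by
    intro i
    simp only [ψ, AlgHom.comp_apply, linSubst_X, map_sum, map_smul, aeval_X, rename_X, ← hg]
    have h1 : ∑ j, (g : Matrix (MatIdx m) (MatIdx m) ℂ) j i • R4 j =
        ∑ j ∈ Finset.univ.filter (fun j : MatIdx m =>
          m * m ≤ (((matIdxEquiv m).symm j : Fin (m * m)) : ℕ) + 4),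
          (g : Matrix (MatIdx m) (MatIdx m) ℂ) j i • (X j : MvPolynomial (MatIdx m) ℂ) := by
      rw [Finset.sum_filter]
      refine Finset.sum_congr rfl fun j _ => ?_
      simp only [hR4]
      split_ifs <;> simp
    rw [h1, hfilter, Finset.sum_map]
    rfl
  set φM : Fin n × Fin n → MvPolynomial (Fin 4) ℂ := fun ij : Fin n × Fin n =>
    ∑ t : Fin 4, M ij t • (X t : MvPolynomial (Fin 4) ℂ) with hφM
  have hψE : ψ.comp (rename E) = (rename κ).comp (aeval φM) :=
    MvPolynomial.algHom_ext fun ij => by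
      simp only [AlgHom.comp_apply, rename_X, hψX, hwE, aeval_X, hφM]
  have hψo : ψ (X o ^ (m - n)) = X (κ 0) ^ (m - n) := by
    by_cases hlt : n < m
    · rw [map_pow, hψX, hwo hlt]
      simp [Pi.single_apply, Finset.sum_ite_eq', rename_X]
    · have h0 : m - n = 0 := by omega
      simp [h0]
  -- derivatives of `f` along block cells, and their images under `ψ`
  have hpd : ∀ ij, pderiv (E ij) f = X o ^ (m - n) * rename E (pderiv ij per) := by
    intro ij
    have hz : pderiv (E ij) (X o ^ (m - n) : MvPolynomial (MatIdx m) ℂ) = 0 := by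
      by_cases hlt : n < m
      · rw [Derivation.leibniz_pow, pderiv_X_of_ne (hEo hlt ij).symm, smul_zero, smul_zero]
      · have h0 : m - n = 0 := by omega
        rw [h0, pow_zero, Derivation.map_one_eq_zero]
    rw [hf, Derivation.leibniz, hz, smul_zero, add_zero, pderiv_rename hE, smul_eq_mul]
  have hψpd : ∀ ij, ψ (pderiv (E ij) f) = X (κ 0) ^ (m - n) * rename κ (aeval φM (pderiv ij per)) := by
    intro ij
    have h1 := AlgHom.congr_fun hψE (pderiv ij per)
    simp only [AlgHom.comp_apply] at h1
    rw [hpd, map_mul, hψo, h1]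
  -- chain rule
  have hchain : ∀ b, aeval R4 (pderiv b (linSubst (MatIdx m) ℂ (g : Matrix (MatIdx m) (MatIdx m) ℂ) f)) =
      ∑ j, (g : Matrix (MatIdx m) (MatIdx m) ℂ) b j • ψ (pderiv j f) := by
    intro b
    rw [pderiv_linSubst_eq_sum, map_sum]
    simp only [map_smul]
    rfl
  -- membership of the transported generators in the four-row span
  set F : {a : MatIdx m // m * m ≤ (((matIdxEquiv m).symm a : Fin (m * m)) : ℕ) + 4} × MatIdx m →
      MvPolynomial (MatIdx m) ℂ := fun ab =>
    (MvPolynomial.X ab.1.1 : MvPolynomial (MatIdx m) ℂ) * MvPolynomial.aeval R4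
      (MvPolynomial.pderiv ab.2 (linSubst (MatIdx m) ℂ ((g : GL (MatIdx m) ℂ) : Matrix (MatIdx m) (MatIdx m) ℂ) f)) with hF
  have hmem : ∀ t ij, X (κ t) * ψ (pderiv (E ij) f) ∈ Submodule.span ℂ (Set.range F) := by
    intro t ij
    have hκt : m * m ≤ (((matIdxEquiv m).symm (κ t) : Fin (m * m)) : ℕ) + 4 := (hkept _).2 ⟨t, rfl⟩
    have h1 : X (κ t) * ψ (pderiv (E ij) f) ∈
        Submodule.span ℂ (Set.range fun j => X (κ t) * ψ (pderiv j f)) :=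
      Submodule.subset_span ⟨E ij, rfl⟩
    rw [← frt_span_range_sum_smul_eq g] at h1
    refine Submodule.span_mono ?_ h1
    rintro _ ⟨b, rfl⟩
    refine ⟨(⟨κ t, hκt⟩, b), ?_⟩
    simp only [hF, hchain b, Finset.mul_sum, mul_smul_comm]
  -- the injective transport `Φ q = ℓ^{m-n} · rename κ q`
  let Φ : MvPolynomial (Fin 4) ℂ →ₗ[ℂ] MvPolynomial (MatIdx m) ℂ :=
    LinearMap.mulLeft ℂ (X (κ 0) ^ (m - n)) ∘ₗ (rename κ).toLinearMap
  have hΦ : Function.Injective Φ := by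
    intro x y h
    simp only [Φ, LinearMap.coe_comp, Function.comp_apply, AlgHom.toLinearMap_apply,
      LinearMap.mulLeft_apply] at h
    exact rename_injective κ hκ
      (mul_right_injective₀ (pow_ne_zero _ (X_ne_zero (κ 0) : (X (κ 0) : MvPolynomial (MatIdx m) ℂ) ≠ 0)) h)
  have hle : (Submodule.span ℂ (Set.range fun tc : Fin 4 × (Fin n × Fin n) =>
        (X tc.1 : MvPolynomial (Fin 4) ℂ) * aeval φM (pderiv tc.2 per))).map Φ ≤
      Submodule.span ℂ (Set.range F) := by
    rw [Submodule.map_span, Submodule.span_le]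
    rintro _ ⟨_, ⟨⟨t, ij⟩, rfl⟩, rfl⟩
    have h := hmem t ij
    rw [hψpd] at h
    simp only [Φ, LinearMap.coe_comp, Function.comp_apply, AlgHom.toLinearMap_apply, map_mul,
      rename_X, LinearMap.mulLeft_apply, SetLike.mem_coe]
    convert h using 1
    ring
  haveI : Module.Finite ℂ ↥(Submodule.span ℂ (Set.range F)) :=
    Module.Finite.span_of_finite ℂ (Set.finite_range F)
  calc Module.finrank ℂ ↥(Submodule.span ℂ (Set.range fun tc : Fin 4 × (Fin n × Fin n) =>
          (X tc.1 : MvPolynomial (Fin 4) ℂ) * aeval φM (pderiv tc.2 per)))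
      = Module.finrank ℂ ↥((Submodule.span ℂ (Set.range fun tc : Fin 4 × (Fin n × Fin n) =>
          (X tc.1 : MvPolynomial (Fin 4) ℂ) * aeval φM (pderiv tc.2 per))).map Φ) :=
        LinearEquiv.finrank_eq (Submodule.equivMapOfInjective Φ hΦ _)
    _ ≤ Module.finrank ℂ ↥(Submodule.span ℂ (Set.range F)) := Submodule.finrank_mono hle

/-- **Reduction of `stub_fourRowPencilRank` to an `m`-free pencil certificate** (line
`four-row-count` of crux `ValuativeGCT.ValuativeFlip`, stmt-ValiantsHypothesis-12624; the
conclusion is the registered stub VERBATIM).  By the transfer `frt_finrank_fourRowSpan_ge`, the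
per-side four-row tangent rank at every level `n ≤ m ≤ (6/5)·n` is at least the dimension of the
`m`-free span `span{y_t · (∂_{ij} per_n)(M(y)) : t < 4, i, j}` of ANY four-variable pencil
`M(y) = (Σ_t M_{ij,t} y_t)_{ij}` with four cells carrying independent forms; so the stub follows
from one certificate per `n`: a pencil with that dimension `≥ 2·⌊6n/5⌋² + ⌊6n/5⌋ + 2`
(numerically the generic value is `min(C(n+3,3), 4n² - 2n + 2) ≥ 2.88 n² + 1.2 n + 2` for
`n ≥ 11`, line card §Stubs).  What remains of the stub is therefore a statement about `per_n`
alone, with no `m`, no padding and no `GL_{m²}`. [this crux's line four-row-count; folklore] -/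
theorem fourRowPencilRank_of_pencilCertificate
    (H : ∃ n₀ : ℕ, ∀ n ≥ n₀, ∃ (M : Fin n × Fin n → Fin 4 → ℂ) (c : Fin 4 → Fin n × Fin n),
      IsUnit (Matrix.of fun t t' : Fin 4 => M (c t') t) ∧
      2 * (6 * n / 5) ^ 2 + 6 * n / 5 + 2 ≤
        Module.finrank ℂ ↥(Submodule.span ℂ (Set.range fun tc : Fin 4 × (Fin n × Fin n) =>
          (X tc.1 : MvPolynomial (Fin 4) ℂ) *
            aeval (fun ij : Fin n × Fin n => ∑ t : Fin 4, M ij t • (X t : MvPolynomial (Fin 4) ℂ))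
              (pderiv tc.2 (perPoly (Fin n) ℂ))))) :
    ∃ n₀ : ℕ, ∀ n ≥ n₀, ∀ (m : ℕ) [NeZero m], n ≤ m → 5 * m ≤ 6 * n →
      ∃ g : GL (MatIdx m) ℂ, 2 * m ^ 2 + m + 2 ≤ Module.finrank ℂ ↥(Submodule.span ℂ (Set.range fun ab : {a : MatIdx m // m * m ≤ (((matIdxEquiv m).symm a : Fin (m * m)) : ℕ) + 4} × MatIdx m => (MvPolynomial.X ab.1.1 : MvPolynomial (MatIdx m) ℂ) * MvPolynomial.aeval (fun i : MatIdx m => if m * m ≤ (((matIdxEquiv m).symm i : Fin (m * m)) : ℕ) + 4 then (MvPolynomial.X i : MvPolynomial (MatIdx m) ℂ) else 0) (MvPolynomial.pderiv ab.2 (linSubst (MatIdx m) ℂ ((g : GL (MatIdx m) ℂ) : Matrix (MatIdx m) (MatIdx m) ℂ) (paddedPerFormLex ℂ n m))))) := by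
  obtain ⟨n₀, hn₀⟩ := H
  refine ⟨max n₀ 2, fun n hn m _ hnm h56 => ?_⟩
  obtain ⟨M, c, hc, hrank⟩ := hn₀ n (le_of_max_le_left hn)
  have hm : 2 ≤ m := (le_of_max_le_right hn).trans hnm
  obtain ⟨g, hg⟩ := frt_finrank_fourRowSpan_ge n m hnm hm M c hc
  refine ⟨g, le_trans ?_ (hrank.trans hg)⟩
  have h1 : m ≤ 6 * n / 5 := (Nat.le_div_iff_mul_le (by norm_num)).2 (by omega)
  have h2 : m ^ 2 ≤ (6 * n / 5) ^ 2 := Nat.pow_le_pow_left h1 2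
  linarith

end

end Summit.ValiantsHypothesis.ValiantsHypothesis.Theorems.ValuativeFlip
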